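import Literature.Probability.LatticeModels.SRWReturnFourier
import HarnessLib

/-!
# Lattice sums of simple-random-walk probabilities on `ℤ⁴` behind the variance of the
# self-intersection local time

Companion to `SRWReturnFourier.lean` (namespace `Literature.Probability.LatticeModels.SRW`),
dimension `d = 4` throughout. The variance of the number of self-intersections of the simple
random walk in a window of length `n` is `O(n)` in `d = 4` (Lawler 1991, §6.4 treats `d = 2`;
Chen 2010, *Random Walk Intersections*, §5.5 the `d ≥ 3` central limit theorems); the proof
reduces to three dimension-dependent lattice sums, bounded here uniformly in the cut-off `L`
from the heat-kernel bounds `pₘ(x) ≤ C/m²` (`prob_four_le`) and the tail bound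
`Σ_{m>n} pₘ(0) ≤ C/n` (`green4_tail_le`):

* `tau a b c = Σ_y p_a(y) p_b(y) p_c(y)` — the probability that three independent walks of
  lengths `a, b, c` from `0` end at a common point (the "interlaced" covariance), its three
  bounds `tau_le_left/mid/right` (`≤ sup p_c · p_{a+b}(0)` etc., Chapman–Kolmogorov), and
  **`sum_tau_le`**: `Σ_{a,b,c ∈ [1,L]} τ(a,b,c) ≤ K₃`;
* parity: `count_zero_of_odd` / `prob_four_zero_of_odd` (`pₘ(0) = 0` for odd `m`; the former is
  also `SAW.Zd.srwCount_zero_eq_zero_of_odd` of `RandomPlanarGeometry/BDGS2012HaraSladeLoops.lean`,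
  a file above this layer) and the monotonicity consequence `prob_four_zero_antitone_even`
  (`p_{w+b}(0) ≤ p_w(0)` for even `b`);
* **`sum_nested_le`**: `Σ_{a,b,c ∈ [1,L]} p_b(0) (p_{a+c}(0) - p_{a+b+c}(0)) ≤ K₄` (termwise
  nonnegative, `nested_term_nonneg`; Abel summation against the tail bound);
* the harmonic bound `sum_inv_le_two_sqrt` (`Σ_{w ≤ m} 1/w ≤ 2√m`) and
  `sum_inv_add_sq_le` (`Σ_{b ≥ 1} 1/(a+b)² ≤ 1/a`).

All folklore, fully proved; the constants `K₃ = tauSumConst`, `K₄ = nestedSumConst` are explicit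
in terms of `retConst 4`, `retConst4` and `ζ(3/2)`-type sums.
-/

noncomputable section

open Finset Real

namespace Literature.Probability.LatticeModels

namespace SRW

/-! ### Elementary real sums -/

/-- `Σ_{w=1}^{m} 1/w ≤ 2√m`. [folklore] -/
theorem sum_inv_le_two_sqrt (m : ℕ) : ∑ w ∈ Finset.Icc 1 m, (1 : ℝ) / w ≤ 2 * Real.sqrt m := by
  induction m with
  | zero => simp
  | succ m ih =>
      rw [Finset.sum_Icc_succ_top (by omega), show m + 1 = m.succ from rfl]
      have hm : (0 : ℝ) ≤ m := Nat.cast_nonneg m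
      have hsq : Real.sqrt (m + 1 : ℝ) - Real.sqrt m ≥ 1 / (2 * Real.sqrt (m + 1 : ℝ)) := by
        have h1 : 0 < Real.sqrt (m + 1 : ℝ) := Real.sqrt_pos.2 (by positivity)
        have h2 : Real.sqrt (m : ℝ) ≤ Real.sqrt (m + 1 : ℝ) := Real.sqrt_le_sqrt (by linarith)
        have key : (Real.sqrt (m + 1 : ℝ) - Real.sqrt m) * (Real.sqrt (m + 1 : ℝ) + Real.sqrt m) = 1 := by
          have := Real.sq_sqrt (show (0 : ℝ) ≤ m + 1 by positivity)
          have := Real.sq_sqrt hm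
          nlinarith
        rw [ge_iff_le, div_le_iff₀ (by positivity)]
        nlinarith [Real.sqrt_nonneg (m : ℝ)]
      push_cast
      calc ∑ w ∈ Finset.Icc 1 m, (1 : ℝ) / w + 1 / (m + 1 : ℝ)
          ≤ 2 * Real.sqrt m + 1 / (m + 1 : ℝ) := by linarith
        _ ≤ 2 * Real.sqrt m + 2 * (Real.sqrt (m + 1 : ℝ) - Real.sqrt m) := by
            have h1 : 0 < Real.sqrt (m + 1 : ℝ) := Real.sqrt_pos.2 (by positivity)
            have h3 : 1 / (m + 1 : ℝ) ≤ 1 / Real.sqrt (m + 1 : ℝ) := by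
              refine one_div_le_one_div_of_le h1 ?_
              calc Real.sqrt (m + 1 : ℝ) ≤ Real.sqrt (m + 1 : ℝ) * Real.sqrt (m + 1 : ℝ) := by
                    have : 1 ≤ Real.sqrt (m + 1 : ℝ) := Real.one_le_sqrt.2 (by linarith)
                    nlinarith
                _ = m + 1 := Real.mul_self_sqrt (by positivity)
            have h4 : 1 / Real.sqrt (m + 1 : ℝ) = 2 * (1 / (2 * Real.sqrt (m + 1 : ℝ))) := by
              field_simp
            linarith [h3, h4, hsq]
        _ = 2 * Real.sqrt (m + 1 : ℝ) := by ring

/-- `Σ_{b=1}^{L} 1/(a+b)² ≤ 1/a` for `a ≥ 1`. [folklore] -/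
theorem sum_inv_add_sq_le {a : ℕ} (ha : 1 ≤ a) (L : ℕ) :
    ∑ b ∈ Finset.Icc 1 L, (1 : ℝ) / ((a + b : ℕ) : ℝ) ^ 2 ≤ 1 / a := by
  have h := sum_Ioc_inv_sq_le_sub (α := ℝ) (k := a) (n := a + L) (by omega) (by omega)
  have heq : ∑ b ∈ Finset.Icc 1 L, (1 : ℝ) / ((a + b : ℕ) : ℝ) ^ 2 =
      ∑ i ∈ Finset.Ioc a (a + L), ((i : ℝ) ^ 2)⁻¹ := by
    have himg : (Finset.Icc 1 L).image (fun b => a + b) = Finset.Ioc a (a + L) := by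
      ext i
      simp only [Finset.mem_image, Finset.mem_Icc, Finset.mem_Ioc]
      constructor
      · rintro ⟨b, ⟨hb1, hb2⟩, rfl⟩; omega
      · intro hi; exact ⟨i - a, by omega, by omega⟩
    rw [← himg, Finset.sum_image (fun b _ b' _ h => Nat.add_left_cancel h)]
    exact Finset.sum_congr rfl fun b _ => by rw [one_div]
  rw [heq]
  refine h.trans ?_
  rw [one_div]
  linarith [inv_nonneg.2 (Nat.cast_nonneg (a + L) : (0 : ℝ) ≤ (a + L : ℕ))]

/-- `Σ_{a,b ∈ [1,L]} 1/(a+b)² ≤ 2√L`. [folklore] -/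
theorem sum_sum_inv_add_sq_le (L : ℕ) :
    ∑ a ∈ Finset.Icc 1 L, ∑ b ∈ Finset.Icc 1 L, (1 : ℝ) / ((a + b : ℕ) : ℝ) ^ 2 ≤ 2 * Real.sqrt L := by
  calc ∑ a ∈ Finset.Icc 1 L, ∑ b ∈ Finset.Icc 1 L, (1 : ℝ) / ((a + b : ℕ) : ℝ) ^ 2
      ≤ ∑ a ∈ Finset.Icc 1 L, (1 : ℝ) / a :=
        Finset.sum_le_sum fun a ha => sum_inv_add_sq_le (Finset.mem_Icc.1 ha).1 L
    _ ≤ 2 * Real.sqrt L := sum_inv_le_two_sqrt L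

/-- The `ζ(3/2)`-type constant `Σ_{c ≥ 1} c^{-3/2}` (as a `tsum` of `(√c)⁻¹/c`). [folklore] -/
def zetaThreeHalves : ℝ := ∑' c : ℕ, (1 : ℝ) / ((c : ℝ) ^ (3 / 2 : ℝ))

/-- Summability of `c^{-3/2}`. [folklore] -/
theorem summable_rpow_three_halves : Summable fun c : ℕ => (1 : ℝ) / ((c : ℝ) ^ (3 / 2 : ℝ)) :=
  Real.summable_one_div_nat_rpow.2 (by norm_num)

/-- `√c / c² = c^{-3/2}` for `c ≥ 1`. [folklore] -/
theorem sqrt_div_sq_eq (c : ℕ) (hc : 1 ≤ c) : Real.sqrt c / (c : ℝ) ^ 2 = 1 / (c : ℝ) ^ (3 / 2 : ℝ) := by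
  have hc' : (0 : ℝ) < c := by exact_mod_cast hc
  rw [Real.sqrt_eq_rpow, div_eq_div_iff (by positivity) (by positivity), one_mul,
    ← Real.rpow_natCast, ← Real.rpow_add hc']
  norm_num

/-- Partial sums of `√c/c²` are bounded by `ζ(3/2)`. [folklore] -/
theorem sum_sqrt_div_sq_le (L : ℕ) : ∑ c ∈ Finset.Icc 1 L, Real.sqrt c / (c : ℝ) ^ 2 ≤ zetaThreeHalves := by
  calc ∑ c ∈ Finset.Icc 1 L, Real.sqrt c / (c : ℝ) ^ 2
      = ∑ c ∈ Finset.Icc 1 L, (1 : ℝ) / (c : ℝ) ^ (3 / 2 : ℝ) :=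
        Finset.sum_congr rfl fun c hc => sqrt_div_sq_eq c (Finset.mem_Icc.1 hc).1
    _ ≤ zetaThreeHalves :=
        summable_rpow_three_halves.sum_le_tsum _ (fun c _ => by positivity)

/-! ### Support bookkeeping for real sums of `prob` -/

/-- A nonnegative function supported in `t` has the same sum over any `s ⊇ t`... here in the form:
sum over `s` of a function vanishing off `t ⊆ s` equals the sum over `t`. [folklore] -/
theorem sum_eq_sum_of_support {s t : Finset (Site 4)} (hts : t ⊆ s) {f : Site 4 → ℝ}
    (hf : ∀ y ∉ t, f y = 0) : ∑ y ∈ s, f y = ∑ y ∈ t, f y :=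
  (Finset.sum_subset hts fun y _ hy => hf y hy).symm

/-- `Σ_{y ∈ box (a+k)} p_a(y) q(y) = Σ_{y ∈ box a} p_a(y) q(y)`. [folklore] -/
theorem sum_box_add_prob_mul (a k : ℕ) (q : Site 4 → ℝ) :
    ∑ y ∈ box 4 (a + k), prob 4 a y * q y = ∑ y ∈ box 4 a, prob 4 a y * q y :=
  sum_eq_sum_of_support (box_mono 4 (Nat.le_add_right a k)) fun y hy => by
    rw [prob_eq_zero_of_not_mem_box hy, zero_mul]

/-- **Chapman–Kolmogorov, diagonal form**: `Σ_{y ∈ box a} p_a(y) p_b(y) = p_{a+b}(0)`. [folklore] -/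
theorem sum_box_prob_mul_prob (a b : ℕ) :
    ∑ y ∈ box 4 a, prob 4 a y * prob 4 b y = prob 4 (a + b) 0 := by
  rw [prob_add]
  refine Finset.sum_congr rfl fun y _ => ?_
  rw [zero_sub, prob_neg]

/-! ### The triple-intersection sum `τ` -/

/-- `τ(a,b,c) = Σ_y p_a(y) p_b(y) p_c(y)`: the probability that three independent simple random
walks on `ℤ⁴` of lengths `a, b, c`, started at `0`, have a common endpoint. [folklore] -/
def tau (a b c : ℕ) : ℝ := ∑ y ∈ box 4 (a + b + c), prob 4 a y * prob 4 b y * prob 4 c y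

/-- `τ ≥ 0`. [folklore] -/
theorem tau_nonneg (a b c : ℕ) : 0 ≤ tau a b c :=
  Finset.sum_nonneg fun y _ => by
    have := prob_nonneg a y; have := prob_nonneg b y; have := prob_nonneg c y; positivity

/-- `τ(a,b,c) ≤ (sup p_c) · p_{a+b}(0) ≤ C₄' C₄ /(c² (a+b)²)`. [folklore] -/
theorem tau_le_right {a b c : ℕ} (ha : 1 ≤ a) (hb : 1 ≤ b) (hc : 1 ≤ c) :
    tau a b c ≤ retConst4 / (c : ℝ) ^ 2 * (retConst 4 / ((a + b : ℕ) : ℝ) ^ 2) := by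
  have hab : prob 4 (a + b) 0 ≤ retConst 4 / ((a + b : ℕ) : ℝ) ^ 2 := prob_four_zero_le (by omega)
  calc tau a b c ≤ ∑ y ∈ box 4 (a + b + c), prob 4 a y * prob 4 b y * (retConst4 / (c : ℝ) ^ 2) :=
        Finset.sum_le_sum fun y _ => mul_le_mul_of_nonneg_left (prob_four_le hc y)
          (mul_nonneg (prob_nonneg a y) (prob_nonneg b y))
    _ = retConst4 / (c : ℝ) ^ 2 * ∑ y ∈ box 4 a, prob 4 a y * prob 4 b y := by
        rw [← Finset.sum_mul, mul_comm, add_assoc, sum_box_add_prob_mul]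
    _ = retConst4 / (c : ℝ) ^ 2 * prob 4 (a + b) 0 := by rw [sum_box_prob_mul_prob]
    _ ≤ retConst4 / (c : ℝ) ^ 2 * (retConst 4 / ((a + b : ℕ) : ℝ) ^ 2) :=
        mul_le_mul_of_nonneg_left hab (by have := one_le_retConst4; positivity)

/-- `τ` is symmetric under swapping the last two arguments. [folklore] -/
theorem tau_swap_right (a b c : ℕ) : tau a b c = tau a c b := by
  unfold tau
  rw [show a + b + c = a + c + b by ring]
  exact Finset.sum_congr rfl fun y _ => by ring

/-- `τ` is symmetric under swapping the first and last arguments. [folklore] -/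
theorem tau_swap_outer (a b c : ℕ) : tau a b c = tau c b a := by
  unfold tau
  rw [show a + b + c = c + b + a by ring]
  exact Finset.sum_congr rfl fun y _ => by ring

/-- `τ(a,b,c) ≤ C₄' C₄ /(b² (a+c)²)`. [folklore] -/
theorem tau_le_mid {a b c : ℕ} (ha : 1 ≤ a) (hb : 1 ≤ b) (hc : 1 ≤ c) :
    tau a b c ≤ retConst4 / (b : ℝ) ^ 2 * (retConst 4 / ((a + c : ℕ) : ℝ) ^ 2) := by
  rw [tau_swap_right]; exact tau_le_right ha hc hb

/-- `τ(a,b,c) ≤ C₄' C₄ /(a² (c+b)²)`. [folklore] -/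
theorem tau_le_left {a b c : ℕ} (ha : 1 ≤ a) (hb : 1 ≤ b) (hc : 1 ≤ c) :
    tau a b c ≤ retConst4 / (a : ℝ) ^ 2 * (retConst 4 / ((c + b : ℕ) : ℝ) ^ 2) := by
  rw [tau_swap_outer]; exact tau_le_right hc hb ha

/-- The constant `K₃ = 6 C₄' C₄ ζ(3/2)` of the triple-intersection sum. [folklore] -/
def tauSumConst : ℝ := 3 * (retConst4 * retConst 4 * (2 * zetaThreeHalves))

/-- The sum over the region where the LAST index is maximal. [folklore] -/
theorem sum_tau_region_le (L : ℕ) :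
    ∑ a ∈ Finset.Icc 1 L, ∑ b ∈ Finset.Icc 1 L, ∑ c ∈ Finset.Icc 1 L,
      (if a ≤ c ∧ b ≤ c then tau a b c else 0) ≤ retConst4 * retConst 4 * (2 * zetaThreeHalves) := by
  have hC4 : 0 ≤ retConst4 := le_trans zero_le_one one_le_retConst4
  have hC : 0 ≤ retConst 4 := (retConst_pos (by norm_num)).le
  -- bound each term by the product bound, restricted to a, b ≤ c
  have hterm : ∀ a ∈ Finset.Icc 1 L, ∀ b ∈ Finset.Icc 1 L, ∀ c ∈ Finset.Icc 1 L,
      (if a ≤ c ∧ b ≤ c then tau a b c else 0) ≤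
        retConst4 * retConst 4 * ((1 : ℝ) / (c : ℝ) ^ 2 *
          (if a ≤ c ∧ b ≤ c then (1 : ℝ) / ((a + b : ℕ) : ℝ) ^ 2 else 0)) := by
    intro a ha b hb c hc
    have ha1 := (Finset.mem_Icc.1 ha).1; have hb1 := (Finset.mem_Icc.1 hb).1
    have hc1 := (Finset.mem_Icc.1 hc).1
    split_ifs with h
    · calc tau a b c ≤ retConst4 / (c : ℝ) ^ 2 * (retConst 4 / ((a + b : ℕ) : ℝ) ^ 2) :=
            tau_le_right ha1 hb1 hc1
        _ = retConst4 * retConst 4 * (1 / (c : ℝ) ^ 2 * (1 / ((a + b : ℕ) : ℝ) ^ 2)) := by ring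
    · simp
  calc ∑ a ∈ Finset.Icc 1 L, ∑ b ∈ Finset.Icc 1 L, ∑ c ∈ Finset.Icc 1 L,
        (if a ≤ c ∧ b ≤ c then tau a b c else 0)
      ≤ ∑ a ∈ Finset.Icc 1 L, ∑ b ∈ Finset.Icc 1 L, ∑ c ∈ Finset.Icc 1 L,
          retConst4 * retConst 4 * ((1 : ℝ) / (c : ℝ) ^ 2 *
            (if a ≤ c ∧ b ≤ c then (1 : ℝ) / ((a + b : ℕ) : ℝ) ^ 2 else 0)) :=
        Finset.sum_le_sum fun a ha => Finset.sum_le_sum fun b hb =>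
          Finset.sum_le_sum fun c hc => hterm a ha b hb c hc
    _ = retConst4 * retConst 4 * ∑ c ∈ Finset.Icc 1 L, (1 : ℝ) / (c : ℝ) ^ 2 *
          ∑ a ∈ Finset.Icc 1 L, ∑ b ∈ Finset.Icc 1 L,
            (if a ≤ c ∧ b ≤ c then (1 : ℝ) / ((a + b : ℕ) : ℝ) ^ 2 else 0) := by
        symm
        rw [Finset.mul_sum]
        simp_rw [Finset.mul_sum]
        rw [Finset.sum_comm]
        refine Finset.sum_congr rfl fun a _ => ?_
        rw [Finset.sum_comm]
    _ ≤ retConst4 * retConst 4 * ∑ c ∈ Finset.Icc 1 L, (1 : ℝ) / (c : ℝ) ^ 2 * (2 * Real.sqrt c) := by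
        refine mul_le_mul_of_nonneg_left (Finset.sum_le_sum fun c hc => ?_) (by positivity)
        refine mul_le_mul_of_nonneg_left ?_ (by positivity)
        have hc1 := (Finset.mem_Icc.1 hc).1
        calc ∑ a ∈ Finset.Icc 1 L, ∑ b ∈ Finset.Icc 1 L,
              (if a ≤ c ∧ b ≤ c then (1 : ℝ) / ((a + b : ℕ) : ℝ) ^ 2 else 0)
            ≤ ∑ a ∈ Finset.Icc 1 c, ∑ b ∈ Finset.Icc 1 c, (1 : ℝ) / ((a + b : ℕ) : ℝ) ^ 2 := by
              calc ∑ a ∈ Finset.Icc 1 L, ∑ b ∈ Finset.Icc 1 L,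
                    (if a ≤ c ∧ b ≤ c then (1 : ℝ) / ((a + b : ℕ) : ℝ) ^ 2 else 0)
                  = ∑ a ∈ Finset.Icc 1 L, ∑ b ∈ Finset.Icc 1 L,
                      (if a ≤ c then (if b ≤ c then (1 : ℝ) / ((a + b : ℕ) : ℝ) ^ 2 else 0) else 0) := by
                    refine Finset.sum_congr rfl fun a _ => Finset.sum_congr rfl fun b _ => ?_
                    split_ifs <;> simp_all
                _ = ∑ a ∈ (Finset.Icc 1 L).filter (· ≤ c), ∑ b ∈ (Finset.Icc 1 L).filter (· ≤ c),
                      (1 : ℝ) / ((a + b : ℕ) : ℝ) ^ 2 := by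
                    rw [Finset.sum_filter]
                    refine Finset.sum_congr rfl fun a _ => ?_
                    split_ifs
                    · rw [Finset.sum_filter]
                    · simp
                _ ≤ ∑ a ∈ Finset.Icc 1 c, ∑ b ∈ Finset.Icc 1 c, (1 : ℝ) / ((a + b : ℕ) : ℝ) ^ 2 := by
                    have hsub : (Finset.Icc 1 L).filter (· ≤ c) ⊆ Finset.Icc 1 c := by
                      intro x hx
                      simp only [Finset.mem_filter, Finset.mem_Icc] at hx ⊢
                      omega
                    calc ∑ a ∈ (Finset.Icc 1 L).filter (· ≤ c), ∑ b ∈ (Finset.Icc 1 L).filter (· ≤ c),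
                          (1 : ℝ) / ((a + b : ℕ) : ℝ) ^ 2
                        ≤ ∑ a ∈ (Finset.Icc 1 L).filter (· ≤ c), ∑ b ∈ Finset.Icc 1 c,
                            (1 : ℝ) / ((a + b : ℕ) : ℝ) ^ 2 :=
                          Finset.sum_le_sum fun a _ =>
                            Finset.sum_le_sum_of_subset_of_nonneg hsub fun b _ _ => by positivity
                      _ ≤ ∑ a ∈ Finset.Icc 1 c, ∑ b ∈ Finset.Icc 1 c, (1 : ℝ) / ((a + b : ℕ) : ℝ) ^ 2 :=
                          Finset.sum_le_sum_of_subset_of_nonneg hsub fun a _ _ =>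
                            Finset.sum_nonneg fun b _ => by positivity
          _ ≤ 2 * Real.sqrt c := sum_sum_inv_add_sq_le c
    _ = retConst4 * retConst 4 * (2 * ∑ c ∈ Finset.Icc 1 L, Real.sqrt c / (c : ℝ) ^ 2) := by
        congr 1
        rw [Finset.mul_sum]
        refine Finset.sum_congr rfl fun c _ => ?_
        ring
    _ ≤ retConst4 * retConst 4 * (2 * zetaThreeHalves) := by
        gcongr
        exact sum_sqrt_div_sq_le L

/-- **The triple-intersection sum is bounded**: `Σ_{a,b,c ∈ [1,L]} τ(a,b,c) ≤ K₃`, uniformly in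
`L` (the "interlaced" contribution to the variance of the self-intersection local time in
`d = 4`). [folklore] -/
theorem sum_tau_le (L : ℕ) :
    ∑ a ∈ Finset.Icc 1 L, ∑ b ∈ Finset.Icc 1 L, ∑ c ∈ Finset.Icc 1 L, tau a b c ≤ tauSumConst := by
  set I := Finset.Icc 1 L with hI
  -- cover by the three regions "a max", "b max", "c max"
  have hif_nonneg : ∀ (q : Prop) [Decidable q] (a b c : ℕ), 0 ≤ (if q then tau a b c else 0) := by
    intro q _ a b c
    split_ifs
    · exact tau_nonneg _ _ _
    · exact le_rfl
  have hcover : ∀ a b c : ℕ, tau a b c ≤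
      (if b ≤ a ∧ c ≤ a then tau a b c else 0) + (if a ≤ b ∧ c ≤ b then tau a b c else 0) +
        (if a ≤ c ∧ b ≤ c then tau a b c else 0) := by
    intro a b c
    have h1 := hif_nonneg (b ≤ a ∧ c ≤ a) a b c
    have h2 := hif_nonneg (a ≤ b ∧ c ≤ b) a b c
    have h3 := hif_nonneg (a ≤ c ∧ b ≤ c) a b c
    rcases (show (b ≤ a ∧ c ≤ a) ∨ (a ≤ b ∧ c ≤ b) ∨ (a ≤ c ∧ b ≤ c) by omega) with h | h | h
    · rw [if_pos h] at h1 ⊢; linarith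
    · rw [if_pos h] at h2 ⊢; linarith
    · rw [if_pos h] at h3 ⊢; linarith
  have hA : ∑ a ∈ I, ∑ b ∈ I, ∑ c ∈ I, (if b ≤ a ∧ c ≤ a then tau a b c else 0) ≤
      retConst4 * retConst 4 * (2 * zetaThreeHalves) := by
    -- reorder to bring `a` innermost and use symmetry τ(a,b,c) = τ(c,b,a)
    have h := sum_tau_region_le L
    calc ∑ a ∈ I, ∑ b ∈ I, ∑ c ∈ I, (if b ≤ a ∧ c ≤ a then tau a b c else 0)
        = ∑ a ∈ I, ∑ b ∈ I, ∑ c ∈ I, (if c ≤ a ∧ b ≤ a then tau c b a else 0) := by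
          refine Finset.sum_congr rfl fun a _ => Finset.sum_congr rfl fun b _ =>
            Finset.sum_congr rfl fun c _ => ?_
          rw [tau_swap_outer a b c]
          congr 1
          exact propext and_comm
      _ = ∑ c ∈ I, ∑ b ∈ I, ∑ a ∈ I, (if c ≤ a ∧ b ≤ a then tau c b a else 0) := by
          rw [Finset.sum_comm]
          exact (Finset.sum_congr rfl fun b _ => Finset.sum_comm).trans Finset.sum_comm
      _ ≤ retConst4 * retConst 4 * (2 * zetaThreeHalves) := h
  have hB : ∑ a ∈ I, ∑ b ∈ I, ∑ c ∈ I, (if a ≤ b ∧ c ≤ b then tau a b c else 0) ≤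
      retConst4 * retConst 4 * (2 * zetaThreeHalves) := by
    have h := sum_tau_region_le L
    calc ∑ a ∈ I, ∑ b ∈ I, ∑ c ∈ I, (if a ≤ b ∧ c ≤ b then tau a b c else 0)
        = ∑ a ∈ I, ∑ b ∈ I, ∑ c ∈ I, (if a ≤ b ∧ c ≤ b then tau a c b else 0) := by
          refine Finset.sum_congr rfl fun a _ => Finset.sum_congr rfl fun b _ =>
            Finset.sum_congr rfl fun c _ => ?_
          rw [tau_swap_right a b c]
      _ = ∑ a ∈ I, ∑ c ∈ I, ∑ b ∈ I, (if a ≤ b ∧ c ≤ b then tau a c b else 0) :=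
          Finset.sum_congr rfl fun a _ => Finset.sum_comm
      _ ≤ retConst4 * retConst 4 * (2 * zetaThreeHalves) := h
  have hC := sum_tau_region_le L
  calc ∑ a ∈ I, ∑ b ∈ I, ∑ c ∈ I, tau a b c
      ≤ ∑ a ∈ I, ∑ b ∈ I, ∑ c ∈ I, ((if b ≤ a ∧ c ≤ a then tau a b c else 0) +
          (if a ≤ b ∧ c ≤ b then tau a b c else 0) + (if a ≤ c ∧ b ≤ c then tau a b c else 0)) :=
        Finset.sum_le_sum fun a _ => Finset.sum_le_sum fun b _ => Finset.sum_le_sum fun c _ => hcover a b c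
    _ = (∑ a ∈ I, ∑ b ∈ I, ∑ c ∈ I, (if b ≤ a ∧ c ≤ a then tau a b c else 0)) +
          (∑ a ∈ I, ∑ b ∈ I, ∑ c ∈ I, (if a ≤ b ∧ c ≤ b then tau a b c else 0)) +
          ∑ a ∈ I, ∑ b ∈ I, ∑ c ∈ I, (if a ≤ c ∧ b ≤ c then tau a b c else 0) := by
        simp only [Finset.sum_add_distrib]
    _ ≤ tauSumConst := by unfold tauSumConst; linarith

/-! ### Parity and monotonicity of the return probabilities -/

/-- The coordinate sum of the endpoint has the parity of the number of steps. [folklore] -/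
theorem sum_endpoint_apply_mod_two {d n : ℕ} (ω : StepSeq d n) :
    (∑ j, endpoint ω j) % 2 = (n : ℤ) % 2 := by
  have h : ∑ j, endpoint ω j = ∑ i : Fin n, (if (ω i).2 then (1 : ℤ) else -1) := by
    unfold endpoint
    simp_rw [Finset.sum_apply]
    rw [Finset.sum_comm]
    exact Finset.sum_congr rfl fun i _ => sum_stepVec_apply (ω i)
  rw [h, Finset.sum_int_mod]
  have h1 : ∀ i : Fin n, ((if (ω i).2 then (1 : ℤ) else -1) % 2) = 1 := by
    intro i; split_ifs <;> decide
  simp_rw [h1]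
  simp

/-- Bipartiteness: a walk of odd length does not return to the origin, `pₘ(0) = 0` for odd `m`.
(Also proved, as `SAW.Zd.srwCount_zero_eq_zero_of_odd`, in
`Literature/Probability/RandomPlanarGeometry/BDGS2012HaraSladeLoops.lean`, which sits above this
layer — it imports the `Barriers` lace-expansion library — so the statement is kept here with its
own five-line proof; the two should be merged by retargeting that file onto this lemma.)
[folklore] -/
theorem count_zero_of_odd {d m : ℕ} (hm : Odd m) : count d m 0 = 0 := by
  rw [count, Finset.card_eq_zero, Finset.filter_eq_empty_iff]
  intro ω _ h
  have hpar := sum_endpoint_apply_mod_two ω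
  rw [h] at hpar
  simp only [Pi.zero_apply, Finset.sum_const_zero, EuclideanDomain.zero_mod] at hpar
  obtain ⟨k, rfl⟩ := hm
  push_cast at hpar
  omega

/-- `pₘ(0) = 0` for odd `m` (on `ℤ⁴`, as on any `ℤ^d`). [folklore] -/
theorem prob_four_zero_of_odd {m : ℕ} (hm : Odd m) : prob 4 m 0 = 0 := by
  simp [prob, count_zero_of_odd hm]

/-- **Monotonicity along even shifts**: `p_{w+b}(0) ≤ p_w(0)` for even `b` (for even `w` this is
the monotonicity of the even return probabilities, for odd `w` both sides vanish). [folklore] -/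
theorem prob_four_zero_antitone_even (w : ℕ) {b : ℕ} (hb : Even b) : prob 4 (w + b) 0 ≤ prob 4 w 0 := by
  rcases Nat.even_or_odd w with ⟨k, rfl⟩ | hw
  · obtain ⟨j, rfl⟩ := hb
    have := prob_add_add_le (d := 4) (by norm_num) k j
    rwa [show k + k + (j + j) = k + j + (k + j) by ring]
  · have h1 : Odd (w + b) := hw.add_even hb
    rw [prob_four_zero_of_odd h1, prob_four_zero_of_odd hw]

/-- Each term of the nested sum is nonnegative:
`0 ≤ p_b(0) (p_{a+c}(0) - p_{a+b+c}(0))`. [folklore] -/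
theorem nested_term_nonneg (a b c : ℕ) :
    0 ≤ prob 4 b 0 * (prob 4 (a + c) 0 - prob 4 (a + b + c) 0) := by
  rcases Nat.even_or_odd b with hb | hb
  · refine mul_nonneg (prob_nonneg b 0) (sub_nonneg.2 ?_)
    rw [show a + b + c = a + c + b by ring]
    exact prob_four_zero_antitone_even (a + c) hb
  · rw [prob_four_zero_of_odd hb, zero_mul]

/-! ### The nested sum -/

/-- Abel summation for the inner nested sum, even shift `b`:
`Σ_{a,c ∈ [1,L]} (p_{a+c}(0) - p_{a+b+c}(0)) ≤ Σ_{w ∈ [1,b+1]} w p_w(0) + b Σ_{w ∈ [b+2, 2L]} p_w(0)`.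
[folklore] -/
theorem sum_nested_inner_le (L : ℕ) {b : ℕ} (hb : Even b) (hb1 : 1 ≤ b) :
    ∑ a ∈ Finset.Icc 1 L, ∑ c ∈ Finset.Icc 1 L, (prob 4 (a + c) 0 - prob 4 (a + b + c) 0) ≤
      ∑ w ∈ Finset.Icc 1 (b + 1), (w : ℝ) * prob 4 w 0 + b * ∑ w ∈ Finset.Icc (b + 2) (2 * L + b), prob 4 w 0 := by
  -- abbreviations
  set p : ℕ → ℝ := fun w => prob 4 w 0 with hp
  have hp0 : ∀ w, 0 ≤ p w := fun w => prob_nonneg w 0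
  have hmono : ∀ w, p (w + b) ≤ p w := fun w => prob_four_zero_antitone_even w hb
  -- Step 1: group the double sum by w = a + c; each term is nonnegative so we may enlarge the
  -- region to the triangle {a, c ≥ 1, a + c ≤ 2L}, whose fibres over w have exactly w - 1 points.
  have hgroup : ∑ a ∈ Finset.Icc 1 L, ∑ c ∈ Finset.Icc 1 L, (p (a + c) - p (a + b + c)) ≤
      ∑ w ∈ Finset.Icc 2 (2 * L), ((w : ℝ) - 1) * (p w - p (w + b)) := by
    have hterm : ∀ a c : ℕ, 0 ≤ p (a + c) - p (a + b + c) := by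
      intro a c
      rw [show a + b + c = a + c + b by ring]
      exact sub_nonneg.2 (hmono (a + c))
    -- write the RHS as a double sum over the triangle
    have hRHS : ∑ w ∈ Finset.Icc 2 (2 * L), ((w : ℝ) - 1) * (p w - p (w + b)) =
        ∑ w ∈ Finset.Icc 2 (2 * L), ∑ a ∈ Finset.Icc 1 (w - 1), (p w - p (w + b)) := by
      refine Finset.sum_congr rfl fun w hw => ?_
      have hw2 := (Finset.mem_Icc.1 hw).1
      rw [Finset.sum_const, Nat.card_Icc, nsmul_eq_mul]
      congr 1
      rw [show w - 1 + 1 - 1 = w - 1 by omega, Nat.cast_sub (by omega : 1 ≤ w), Nat.cast_one]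
    rw [hRHS]
    -- reindex LHS: (a, c) ↦ (w, a) with w = a + c
    rw [Finset.sum_sigma' (Finset.Icc 1 L) (fun _ => Finset.Icc 1 L),
      Finset.sum_sigma' (Finset.Icc 2 (2 * L)) (fun w => Finset.Icc 1 (w - 1))]
    set e : (_ : ℕ) × ℕ → (_ : ℕ) × ℕ := fun x => ⟨x.1 + x.2, x.1⟩ with he
    set S := (Finset.Icc 1 L).sigma (fun _ => Finset.Icc 1 L) with hS
    set Tt := (Finset.Icc 2 (2 * L)).sigma (fun w => Finset.Icc 1 (w - 1)) with hT
    have hinj : Set.InjOn e S := by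
      intro x _ y _ h
      simp only [he, Sigma.mk.inj_iff, heq_eq_eq] at h
      obtain ⟨h1, h2⟩ := h
      have h3 : x.2 = y.2 := by omega
      exact Sigma.ext h2 (heq_of_eq h3)
    have hmaps : S.image e ⊆ Tt := by
      intro y hy
      rw [Finset.mem_image] at hy
      obtain ⟨x, hx, rfl⟩ := hy
      rw [hS, Finset.mem_sigma, Finset.mem_Icc, Finset.mem_Icc] at hx
      rw [hT, Finset.mem_sigma, Finset.mem_Icc, Finset.mem_Icc]
      simp only [he]
      omega
    calc ∑ x ∈ S, (p (x.1 + x.2) - p (x.1 + b + x.2))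
        = ∑ x ∈ S, (p (e x).1 - p ((e x).1 + b)) :=
          Finset.sum_congr rfl fun x _ => by
            simp only [he]; rw [show x.1 + b + x.2 = x.1 + x.2 + b by ring]
      _ = ∑ y ∈ S.image e, (p y.1 - p (y.1 + b)) :=
          (Finset.sum_image (f := fun y : (_ : ℕ) × ℕ => p y.1 - p (y.1 + b)) hinj).symm
      _ ≤ ∑ y ∈ Tt, (p y.1 - p (y.1 + b)) :=
          Finset.sum_le_sum_of_subset_of_nonneg hmaps fun y _ _ => sub_nonneg.2 (hmono y.1)
  -- Step 2: Abel summation of the weighted telescoping sum.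
  have habel : ∑ w ∈ Finset.Icc 2 (2 * L), ((w : ℝ) - 1) * (p w - p (w + b)) ≤
      ∑ w ∈ Finset.Icc 1 (b + 1), (w : ℝ) * p w + b * ∑ w ∈ Finset.Icc (b + 2) (2 * L + b), p w := by
    have hexp : ∑ w ∈ Finset.Icc 2 (2 * L), ((w : ℝ) - 1) * (p w - p (w + b)) =
        ∑ w ∈ Finset.Icc 2 (2 * L), ((w : ℝ) - 1) * p w -
          ∑ w ∈ Finset.Icc 2 (2 * L), ((w : ℝ) - 1) * p (w + b) := by
      rw [← Finset.sum_sub_distrib]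
      exact Finset.sum_congr rfl fun w _ => by ring
    rw [hexp]
    -- shift the second sum: w ↦ v = w + b
    have hshift : ∑ w ∈ Finset.Icc 2 (2 * L), ((w : ℝ) - 1) * p (w + b) =
        ∑ v ∈ Finset.Icc (b + 2) (2 * L + b), ((v : ℝ) - b - 1) * p v := by
      have himg : (Finset.Icc 2 (2 * L)).image (fun w => w + b) = Finset.Icc (b + 2) (2 * L + b) := by
        ext v
        simp only [Finset.mem_image, Finset.mem_Icc]
        constructor
        · rintro ⟨w, ⟨h1, h2⟩, rfl⟩; omega
        · intro h; exact ⟨v - b, by omega, by omega⟩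
      rw [← himg, Finset.sum_image (fun w _ w' _ h => Nat.add_right_cancel h)]
      refine Finset.sum_congr rfl fun w _ => ?_
      push_cast; ring
    rw [hshift]
    -- split the first sum at b + 1 and compare termwise
    have hsplit : ∑ w ∈ Finset.Icc 2 (2 * L), ((w : ℝ) - 1) * p w ≤
        ∑ w ∈ Finset.Icc 1 (b + 1), (w : ℝ) * p w + ∑ w ∈ Finset.Icc (b + 2) (2 * L + b), ((w : ℝ) - 1) * p w := by
      have hsub : Finset.Icc 2 (2 * L) ⊆ Finset.Icc 1 (b + 1) ∪ Finset.Icc (b + 2) (2 * L + b) := by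
        intro w hw
        simp only [Finset.mem_union, Finset.mem_Icc] at hw ⊢
        omega
      calc ∑ w ∈ Finset.Icc 2 (2 * L), ((w : ℝ) - 1) * p w
          ≤ ∑ w ∈ Finset.Icc 1 (b + 1) ∪ Finset.Icc (b + 2) (2 * L + b), ((w : ℝ) - 1) * p w :=
            Finset.sum_le_sum_of_subset_of_nonneg hsub fun w hw _ => by
              have : (1 : ℝ) ≤ w := by
                simp only [Finset.mem_union, Finset.mem_Icc] at hw
                exact_mod_cast (by omega : 1 ≤ w)
              exact mul_nonneg (by linarith) (hp0 w)
        _ = ∑ w ∈ Finset.Icc 1 (b + 1), ((w : ℝ) - 1) * p w +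
              ∑ w ∈ Finset.Icc (b + 2) (2 * L + b), ((w : ℝ) - 1) * p w := by
            refine Finset.sum_union ?_
            rw [Finset.disjoint_left]
            intro w h1 h2
            simp only [Finset.mem_Icc] at h1 h2
            omega
        _ ≤ ∑ w ∈ Finset.Icc 1 (b + 1), (w : ℝ) * p w +
              ∑ w ∈ Finset.Icc (b + 2) (2 * L + b), ((w : ℝ) - 1) * p w :=
            add_le_add (Finset.sum_le_sum fun w _ => by linarith [hp0 w]) le_rfl
    calc ∑ w ∈ Finset.Icc 2 (2 * L), ((w : ℝ) - 1) * p w -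
          ∑ v ∈ Finset.Icc (b + 2) (2 * L + b), ((v : ℝ) - b - 1) * p v
        ≤ ∑ w ∈ Finset.Icc 1 (b + 1), (w : ℝ) * p w +
            ∑ w ∈ Finset.Icc (b + 2) (2 * L + b), ((w : ℝ) - 1) * p w -
            ∑ v ∈ Finset.Icc (b + 2) (2 * L + b), ((v : ℝ) - b - 1) * p v := by linarith
      _ = ∑ w ∈ Finset.Icc 1 (b + 1), (w : ℝ) * p w + b * ∑ w ∈ Finset.Icc (b + 2) (2 * L + b), p w := by
          rw [Finset.mul_sum, add_sub_assoc, ← Finset.sum_sub_distrib]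
          congr 1
          refine Finset.sum_congr rfl fun w _ => by ring
  exact hgroup.trans habel

/-- The constant `K₄ = C₄ (2 C₄ √2 ζ(3/2) + C₄ ζ-type + …)` of the nested sum:
`K₄ = C₄ · (2√2 C₄ ζ(3/2) + 2 C₄)`. [folklore] -/
def nestedSumConst : ℝ := retConst 4 * (2 * Real.sqrt 2 * retConst 4 * zetaThreeHalves + 2 * retConst 4)

/-- **The nested sum is bounded**: `Σ_{a,b,c ∈ [1,L]} p_b(0) (p_{a+c}(0) - p_{a+b+c}(0)) ≤ K₄`,
uniformly in `L` (the "nested" contribution to the variance of the self-intersection local time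
in `d = 4`; the cancellation inside the bracket is essential). [folklore] -/
theorem sum_nested_le (L : ℕ) :
    ∑ a ∈ Finset.Icc 1 L, ∑ b ∈ Finset.Icc 1 L, ∑ c ∈ Finset.Icc 1 L,
      prob 4 b 0 * (prob 4 (a + c) 0 - prob 4 (a + b + c) 0) ≤ nestedSumConst := by
  have hC : 0 ≤ retConst 4 := (retConst_pos (by norm_num)).le
  -- bring b outermost
  rw [Finset.sum_comm]
  -- bound the inner (a, c) sums for each b
  have hinner : ∀ b ∈ Finset.Icc 1 L, ∑ a ∈ Finset.Icc 1 L, ∑ c ∈ Finset.Icc 1 L,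
      prob 4 b 0 * (prob 4 (a + c) 0 - prob 4 (a + b + c) 0) ≤
        retConst 4 / (b : ℝ) ^ 2 * (2 * retConst 4 * Real.sqrt (b + 1 : ℕ) + retConst 4) := by
    intro b hb
    have hb1 := (Finset.mem_Icc.1 hb).1
    rcases Nat.even_or_odd b with hbe | hbo
    · simp_rw [← Finset.mul_sum]
      have hpb : prob 4 b 0 ≤ retConst 4 / (b : ℝ) ^ 2 := prob_four_zero_le hb1
      have hin := sum_nested_inner_le L hbe hb1
      have hin_nonneg : 0 ≤ ∑ a ∈ Finset.Icc 1 L, ∑ c ∈ Finset.Icc 1 L,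
          (prob 4 (a + c) 0 - prob 4 (a + b + c) 0) :=
        Finset.sum_nonneg fun a _ => Finset.sum_nonneg fun c _ => by
          rw [show a + b + c = a + c + b by ring]
          exact sub_nonneg.2 (prob_four_zero_antitone_even _ hbe)
      -- bound the two pieces of the Abel bound
      have h1 : ∑ w ∈ Finset.Icc 1 (b + 1), (w : ℝ) * prob 4 w 0 ≤ 2 * retConst 4 * Real.sqrt (b + 1 : ℕ) := by
        calc ∑ w ∈ Finset.Icc 1 (b + 1), (w : ℝ) * prob 4 w 0
            ≤ ∑ w ∈ Finset.Icc 1 (b + 1), retConst 4 * ((1 : ℝ) / w) :=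
              Finset.sum_le_sum fun w hw => by
                have hw1 := (Finset.mem_Icc.1 hw).1
                have hw' : (0 : ℝ) < w := by exact_mod_cast hw1
                calc (w : ℝ) * prob 4 w 0 ≤ w * (retConst 4 / (w : ℝ) ^ 2) :=
                      mul_le_mul_of_nonneg_left (prob_four_zero_le hw1) hw'.le
                  _ = retConst 4 * (1 / w) := by field_simp
          _ = retConst 4 * ∑ w ∈ Finset.Icc 1 (b + 1), (1 : ℝ) / w := by rw [Finset.mul_sum]
          _ ≤ retConst 4 * (2 * Real.sqrt (b + 1 : ℕ)) :=
              mul_le_mul_of_nonneg_left (sum_inv_le_two_sqrt (b + 1)) hC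
          _ = 2 * retConst 4 * Real.sqrt (b + 1 : ℕ) := by ring
      have h2 : (b : ℝ) * ∑ w ∈ Finset.Icc (b + 2) (2 * L + b), prob 4 w 0 ≤ retConst 4 := by
        have htail : ∑ w ∈ Finset.Icc (b + 2) (2 * L + b), prob 4 w 0 ≤ retConst 4 / (b + 1 : ℕ) := by
          have hsum : Summable fun m => prob 4 (m + (b + 1 + 1)) 0 :=
            (summable_nat_add_iff (f := fun m => prob 4 m 0) (b + 1 + 1)).2 summable_prob_four_zero
          calc ∑ w ∈ Finset.Icc (b + 2) (2 * L + b), prob 4 w 0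
              = ∑ m ∈ Finset.range (2 * L - 1), prob 4 (m + (b + 1 + 1)) 0 := by
                rw [← Finset.sum_image (s := Finset.range (2 * L - 1)) (g := fun m => m + (b + 1 + 1))
                  (f := fun w => prob 4 w 0) (fun m _ m' _ h => Nat.add_right_cancel h)]
                refine Finset.sum_congr ?_ fun _ _ => rfl
                ext w
                simp only [Finset.mem_Icc, Finset.mem_image, Finset.mem_range]
                constructor
                · intro h; exact ⟨w - (b + 2), by omega, by omega⟩
                · rintro ⟨m, hm, rfl⟩; omega
            _ ≤ ∑' m, prob 4 (m + (b + 1 + 1)) 0 := hsum.sum_le_tsum _ (fun m _ => prob_nonneg _ _)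
            _ ≤ retConst 4 / (b + 1 : ℕ) := green4_tail_le (by omega)
        have hb' : (0 : ℝ) < b := by exact_mod_cast hb1
        calc (b : ℝ) * ∑ w ∈ Finset.Icc (b + 2) (2 * L + b), prob 4 w 0
            ≤ b * (retConst 4 / (b + 1 : ℕ)) := mul_le_mul_of_nonneg_left htail hb'.le
          _ ≤ retConst 4 := by
              rw [mul_div_assoc']
              rw [div_le_iff₀ (by positivity)]
              push_cast
              nlinarith
      calc prob 4 b 0 * ∑ a ∈ Finset.Icc 1 L, ∑ c ∈ Finset.Icc 1 L,
            (prob 4 (a + c) 0 - prob 4 (a + b + c) 0)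
          ≤ retConst 4 / (b : ℝ) ^ 2 * ∑ a ∈ Finset.Icc 1 L, ∑ c ∈ Finset.Icc 1 L,
              (prob 4 (a + c) 0 - prob 4 (a + b + c) 0) :=
            mul_le_mul_of_nonneg_right hpb hin_nonneg
        _ ≤ retConst 4 / (b : ℝ) ^ 2 * (2 * retConst 4 * Real.sqrt (b + 1 : ℕ) + retConst 4) :=
            mul_le_mul_of_nonneg_left (hin.trans (by linarith)) (by positivity)
    · have : ∀ a c : ℕ, prob 4 b 0 * (prob 4 (a + c) 0 - prob 4 (a + b + c) 0) = 0 := by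
        intro a c; rw [prob_four_zero_of_odd hbo, zero_mul]
      simp only [this, Finset.sum_const_zero]
      positivity
  calc ∑ b ∈ Finset.Icc 1 L, ∑ a ∈ Finset.Icc 1 L, ∑ c ∈ Finset.Icc 1 L,
        prob 4 b 0 * (prob 4 (a + c) 0 - prob 4 (a + b + c) 0)
      ≤ ∑ b ∈ Finset.Icc 1 L, retConst 4 / (b : ℝ) ^ 2 * (2 * retConst 4 * Real.sqrt (b + 1 : ℕ) + retConst 4) :=
        Finset.sum_le_sum hinner
    _ ≤ ∑ b ∈ Finset.Icc 1 L, retConst 4 * (2 * Real.sqrt 2 * retConst 4 * (Real.sqrt b / (b : ℝ) ^ 2) +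
          retConst 4 * (1 / (b : ℝ) ^ 2)) := by
        refine Finset.sum_le_sum fun b hb => ?_
        have hb1 := (Finset.mem_Icc.1 hb).1
        have hb' : (1 : ℝ) ≤ b := by exact_mod_cast hb1
        have hsq : Real.sqrt (b + 1 : ℕ) ≤ Real.sqrt 2 * Real.sqrt b := by
          rw [← Real.sqrt_mul (by norm_num)]
          exact Real.sqrt_le_sqrt (by push_cast; linarith)
        have hpos : (0 : ℝ) < (b : ℝ) ^ 2 := by positivity
        calc retConst 4 / (b : ℝ) ^ 2 * (2 * retConst 4 * Real.sqrt (b + 1 : ℕ) + retConst 4)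
            ≤ retConst 4 / (b : ℝ) ^ 2 * (2 * retConst 4 * (Real.sqrt 2 * Real.sqrt b) + retConst 4) := by
              gcongr
          _ = retConst 4 * (2 * Real.sqrt 2 * retConst 4 * (Real.sqrt b / (b : ℝ) ^ 2) +
                retConst 4 * (1 / (b : ℝ) ^ 2)) := by
              field_simp
    _ = retConst 4 * (2 * Real.sqrt 2 * retConst 4 * ∑ b ∈ Finset.Icc 1 L, Real.sqrt b / (b : ℝ) ^ 2 +
          retConst 4 * ∑ b ∈ Finset.Icc 1 L, (1 / (b : ℝ) ^ 2)) := by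
        rw [Finset.mul_sum, Finset.mul_sum, ← Finset.sum_add_distrib, Finset.mul_sum]
    _ ≤ retConst 4 * (2 * Real.sqrt 2 * retConst 4 * zetaThreeHalves + retConst 4 * 2) := by
        have h1 := sum_sqrt_div_sq_le L
        have h2 : ∑ b ∈ Finset.Icc 1 L, (1 / (b : ℝ) ^ 2) ≤ 2 := by
          rcases Nat.eq_zero_or_pos L with rfl | hL
          · simp
          · have h := sum_Ioc_inv_sq_le_sub (α := ℝ) (k := 1) (n := L) one_ne_zero hL
            have hL' : (0 : ℝ) ≤ (L : ℝ)⁻¹ := by positivity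
            have hIoc : ∑ i ∈ Finset.Ioc 1 L, ((i : ℝ) ^ 2)⁻¹ ≤ 1 := by
              have h1 : ((1 : ℕ) : ℝ)⁻¹ = 1 := by norm_num
              linarith [h, h1]
            calc ∑ b ∈ Finset.Icc 1 L, (1 / (b : ℝ) ^ 2)
                = 1 / ((1 : ℕ) : ℝ) ^ 2 + ∑ b ∈ Finset.Ioc 1 L, (1 / (b : ℝ) ^ 2) := by
                  rw [← Finset.Ioc_insert_left hL, Finset.sum_insert (by simp)]
              _ = 1 + ∑ i ∈ Finset.Ioc 1 L, ((i : ℝ) ^ 2)⁻¹ := by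
                  simp only [one_div]; norm_num
              _ ≤ 2 := by linarith
        gcongr
    _ = nestedSumConst := by unfold nestedSumConst; ring

end SRW

end Literature.Probability.LatticeModels
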